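import Mathlib.Analysis.Complex.Exponential
import Literature.Computability.AlgebraicComplexity.FixedPointLog
import HarnessLib

/-!
# Kernel-evaluable fixed-point enclosures of exponentials, with soundness

Topic `Literature/Computability/AlgebraicComplexity`; second file of the reflective numerics kit of
`FixedPointLog.lean` (purpose, pattern and conventions as there).  The laser-method constraint
programs (Alman–Duan–Vassilevska Williams–Xu–Xu–Zhou 2025, §7; VXXZ 2024, §8) bound their penalty
terms `P_α = max_{α' ∈ D} H(α') − H(α)` through Lagrange multipliers, i.e. through the dual function
`log Σ exp(λ_X + λ_Y + λ_Z) − ⟨λ, marginals⟩` (`MaxEntropyGivenMarginals.maxEntropyGivenMarginals_le_entropyDual`);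
a kernel check of a feasible point therefore needs certified UPPER (and lower) bounds on `exp` of
rationals.  For precision `P`, `N ≥ 1` Taylor terms and a squaring hint `s`:

* `FixedPoint.expLoSmall/expHiSmall P N rn rd` — `2^P · exp(r)`, `r = rn/rd ∈ [0, 1]`, by the Taylor
  polynomial in fixed point with directed rounding, the upper value adding Mathlib's remainder
  `r^N (N+1)/(N! N)` (`Real.exp_bound'`; lower: `Real.sum_le_exp_of_nonneg`):
  `expLoSmall_sound`, `expHiSmall_sound`;
* `FixedPoint.sqIter` — `s` directed squarings (`exp(2^s r) = exp(r)^{2^s}`): `sqIter_false_sound`,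
  `sqIter_true_sound`;
* `FixedPoint.expLo/expHi P N s xnum xden` — **`2^P · exp(xnum/xden)` for an integer `xnum` and the
  hint `|xnum| ≤ xden · 2^s`** (checked by `FixedPoint.expHintOk`), negative arguments through
  `exp(−x) = 1/exp(x)`: `expLo_sound`, `expHi_sound`, `exp_sound_of_hintOk`.

All code is structural recursion on `ℕ` with `ℕ`/`ℤ` arithmetic (kernel-reducible); everything is
proved, no named facts.

## References

* Standard material (Taylor polynomial with Lagrange-type remainder, argument halving and repeated
  squaring), e.g. J.-M. Muller, *Elementary Functions* (3rd ed., 2016), Ch. 4; every statement here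
  is [folklore], the analytic inputs are Mathlib's `Real.exp_bound'` and `Real.sum_le_exp_of_nonneg`.
* J. Alman, R. Duan, V. Vassilevska Williams, Y. Xu, Z. Xu, R. Zhou, SODA 2025, arXiv:2404.16349,
  §7 ("using the exponential form of Lagrange multiplier constraints").
  [AlmanDuanVassilevskaWilliamsXuXuZhou2025]
-/

noncomputable section

open scoped BigOperators Nat
open Finset

namespace Literature.Computability.AlgebraicComplexity

namespace FixedPoint

/-! ## The Taylor loop -/

/-- One step of the fixed-point Taylor polynomial of `exp` at `r = rn/rd`: the state `(T, j, A)`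
(`T ≈ C r^j/j!`, index, accumulator) goes to `(T · rn/(rd (j+1)), j+1, A + T)`, the division
rounded down (`up = false`) or up. [folklore] -/
def expStep (up : Bool) (rn rd : ℕ) (s : ℕ × ℕ × ℕ) : ℕ × ℕ × ℕ :=
  bif up then (cdiv (s.1 * rn) (rd * (s.2.1 + 1)), s.2.1 + 1, s.2.2 + s.1)
  else (s.1 * rn / (rd * (s.2.1 + 1)), s.2.1 + 1, s.2.2 + s.1)

/-- `N` steps of `expStep`. [folklore] -/
def expIter (up : Bool) (rn rd : ℕ) (s : ℕ × ℕ × ℕ) : ℕ → ℕ × ℕ × ℕ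
  | 0 => s
  | N + 1 => expStep up rn rd (expIter up rn rd s N)

/-- Unfolding one step. [folklore] -/
theorem expIter_succ (up : Bool) (rn rd : ℕ) (s : ℕ × ℕ × ℕ) (N : ℕ) :
    expIter up rn rd s (N + 1) = expStep up rn rd (expIter up rn rd s N) := rfl

/-- The downward step, unfolded. [folklore] -/
theorem expStep_false (rn rd : ℕ) (s : ℕ × ℕ × ℕ) :
    expStep false rn rd s = (s.1 * rn / (rd * (s.2.1 + 1)), s.2.1 + 1, s.2.2 + s.1) := rfl

/-- The upward step, unfolded. [folklore] -/
theorem expStep_true (rn rd : ℕ) (s : ℕ × ℕ × ℕ) :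
    expStep true rn rd s = (cdiv (s.1 * rn) (rd * (s.2.1 + 1)), s.2.1 + 1, s.2.2 + s.1) := rfl

/-- The real Taylor partial sums `Σ_{j<N} r^j/j!`. [folklore] -/
def expPartial (r : ℝ) (N : ℕ) : ℝ := ∑ j ∈ range N, r ^ j / j !

/-- `S_{N+1} = S_N + r^N/N!`. [folklore] -/
theorem expPartial_succ (r : ℝ) (N : ℕ) : expPartial r (N + 1) = expPartial r N + r ^ N / N ! := by
  unfold expPartial
  rw [sum_range_succ]

/-- `r^{N+1}/(N+1)! = (r^N/N!) · r/(N+1)`. [folklore] -/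
theorem pow_div_factorial_succ (r : ℝ) (N : ℕ) :
    r ^ (N + 1) / (N + 1)! = r ^ N / N ! * (r / (N + 1)) := by
  rw [Nat.factorial_succ, pow_succ]
  push_cast
  have hN : (N ! : ℝ) ≠ 0 := by exact_mod_cast (Nat.factorial_pos N).ne'
  field_simp

/-- **Invariant of the downward Taylor loop**: after `N` steps from `(C, 0, 0)` the index is `N`,
`T ≤ C r^N/N!` and `A ≤ C Σ_{j<N} r^j/j!` (`r = rn/rd ≥ 0`). [folklore] -/
theorem expIter_false_inv {rn rd : ℕ} {r : ℝ} (hr : (rn : ℝ) / rd = r) (hr0 : 0 ≤ r) (C N : ℕ) :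
    (expIter false rn rd (C, 0, 0) N).2.1 = N ∧
      ((expIter false rn rd (C, 0, 0) N).1 : ℝ) ≤ C * (r ^ N / N !) ∧
      ((expIter false rn rd (C, 0, 0) N).2.2 : ℝ) ≤ C * expPartial r N := by
  induction N with
  | zero =>
    refine ⟨rfl, ?_, ?_⟩
    · simp [expIter]
    · simp [expIter, expPartial]
  | succ N ih =>
    obtain ⟨hk, hT, hA⟩ := ih
    rw [expIter_succ, expStep_false]
    set s := expIter false rn rd (C, 0, 0) N with hs
    dsimp only
    refine ⟨by rw [hk], ?_, ?_⟩
    · rw [hk]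
      calc ((s.1 * rn / (rd * (N + 1)) : ℕ) : ℝ) ≤ ((s.1 * rn : ℕ) : ℝ) / ((rd * (N + 1) : ℕ) : ℝ) :=
            natDiv_le_div _ _
        _ = (s.1 : ℝ) * (((rn : ℝ) / rd) / (N + 1)) := by
            push_cast
            rw [mul_div_assoc, div_div]
        _ ≤ C * (r ^ N / N !) * (r / (N + 1)) := by
            rw [hr]; exact mul_le_mul_of_nonneg_right hT (by positivity)
        _ = C * (r ^ (N + 1) / (N + 1)!) := by rw [pow_div_factorial_succ]; ring
    · calc ((s.2.2 + s.1 : ℕ) : ℝ) = (s.2.2 : ℝ) + s.1 := by push_cast; ring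
        _ ≤ C * expPartial r N + C * (r ^ N / N !) := add_le_add hA hT
        _ = C * expPartial r (N + 1) := by rw [expPartial_succ]; ring

/-- **Invariant of the upward Taylor loop** (`rd > 0`): index `N`, `C r^N/N! ≤ T`, `C Σ_{j<N} r^j/j! ≤ A`. [folklore] -/
theorem expIter_true_inv {rn rd : ℕ} (hrd : 0 < rd) {r : ℝ} (hr : (rn : ℝ) / rd = r) (hr0 : 0 ≤ r)
    (C N : ℕ) :
    (expIter true rn rd (C, 0, 0) N).2.1 = N ∧
      (C : ℝ) * (r ^ N / N !) ≤ ((expIter true rn rd (C, 0, 0) N).1 : ℝ) ∧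
      (C : ℝ) * expPartial r N ≤ ((expIter true rn rd (C, 0, 0) N).2.2 : ℝ) := by
  induction N with
  | zero =>
    refine ⟨rfl, ?_, ?_⟩
    · simp [expIter]
    · simp [expIter, expPartial]
  | succ N ih =>
    obtain ⟨hk, hT, hA⟩ := ih
    rw [expIter_succ, expStep_true]
    set s := expIter true rn rd (C, 0, 0) N with hs
    dsimp only
    refine ⟨by rw [hk], ?_, ?_⟩
    · rw [hk]
      calc (C : ℝ) * (r ^ (N + 1) / (N + 1)!) = C * (r ^ N / N !) * (r / (N + 1)) := by
            rw [pow_div_factorial_succ]; ring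
        _ ≤ (s.1 : ℝ) * (((rn : ℝ) / rd) / (N + 1)) := by
            rw [hr]; exact mul_le_mul_of_nonneg_right hT (by positivity)
        _ = ((s.1 * rn : ℕ) : ℝ) / ((rd * (N + 1) : ℕ) : ℝ) := by
            push_cast
            rw [mul_div_assoc, div_div]
        _ ≤ (cdiv (s.1 * rn) (rd * (N + 1)) : ℝ) := div_le_cdiv (Nat.mul_pos hrd (Nat.succ_pos N))
    · calc (C : ℝ) * expPartial r (N + 1) = C * expPartial r N + C * (r ^ N / N !) := by
            rw [expPartial_succ]; ring
        _ ≤ (s.2.2 : ℝ) + s.1 := add_le_add hA hT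
        _ = ((s.2.2 + s.1 : ℕ) : ℝ) := by push_cast; ring

/-! ## `exp` on `[0, 1]` -/

/-- **`2^P exp(rn/rd)` from below** (`N` Taylor terms, rounded down). [folklore] -/
def expLoSmall (P N rn rd : ℕ) : ℕ := (expIter false rn rd (2 ^ P, 0, 0) N).2.2

/-- **`2^P exp(rn/rd)` from above**: `N` Taylor terms rounded up plus the remainder
`⌈T_N (N+1)/N⌉ ≥ 2^P r^N (N+1)/(N! N)`. [folklore] -/
def expHiSmall (P N rn rd : ℕ) : ℕ :=
  (expIter true rn rd (2 ^ P, 0, 0) N).2.2 + cdiv ((expIter true rn rd (2 ^ P, 0, 0) N).1 * (N + 1)) N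

/-- **Soundness of `expLoSmall`** (`0 ≤ r`): `expLoSmall ≤ 2^P exp r`. [folklore] -/
theorem expLoSmall_sound (P N : ℕ) {rn rd : ℕ} (hrd : 0 < rd) :
    (expLoSmall P N rn rd : ℝ) ≤ (2 : ℝ) ^ P * Real.exp ((rn : ℝ) / rd) := by
  have hr0 : (0 : ℝ) ≤ (rn : ℝ) / rd := by positivity
  obtain ⟨-, -, hA⟩ := expIter_false_inv rfl hr0 (2 ^ P) N
  have hexp := Real.sum_le_exp_of_nonneg hr0 N
  calc (expLoSmall P N rn rd : ℝ) ≤ ((2 ^ P : ℕ) : ℝ) * expPartial ((rn : ℝ) / rd) N := hA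
    _ ≤ (2 : ℝ) ^ P * Real.exp ((rn : ℝ) / rd) := by
        push_cast
        exact mul_le_mul_of_nonneg_left hexp (by positivity)

/-- **Soundness of `expHiSmall`** (`0 < rd`, `rn ≤ rd`, `0 < N`): `2^P exp r ≤ expHiSmall`. [folklore] -/
theorem expHiSmall_sound (P : ℕ) {N rn rd : ℕ} (hN : 0 < N) (hrd : 0 < rd) (hle : rn ≤ rd) :
    (2 : ℝ) ^ P * Real.exp ((rn : ℝ) / rd) ≤ (expHiSmall P N rn rd : ℝ) := by
  have hrdR : (0 : ℝ) < rd := by exact_mod_cast hrd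
  have hr0 : (0 : ℝ) ≤ (rn : ℝ) / rd := by positivity
  have hr1 : (rn : ℝ) / rd ≤ 1 := by
    rw [div_le_one hrdR]; exact_mod_cast hle
  obtain ⟨-, hT, hA⟩ := expIter_true_inv hrd rfl hr0 (2 ^ P) N
  set s := expIter true rn rd (2 ^ P, 0, 0) N with hs
  have hexp := Real.exp_bound' hr0 hr1 hN
  have hNR : (0 : ℝ) < N := by exact_mod_cast hN
  -- the remainder
  have hrem : (2 : ℝ) ^ P * (((rn : ℝ) / rd) ^ N * (N + 1) / (N ! * N)) ≤
      ((cdiv (s.1 * (N + 1)) N : ℕ) : ℝ) := by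
    refine le_trans ?_ (div_le_cdiv hN)
    push_cast
    rw [le_div_iff₀ hNR]
    have hfac : (0 : ℝ) < N ! := by exact_mod_cast Nat.factorial_pos N
    have h1 : (2 : ℝ) ^ P * (((rn : ℝ) / rd) ^ N * (N + 1) / (N ! * N)) * N =
        (2 : ℝ) ^ P * (((rn : ℝ) / rd) ^ N / N !) * (N + 1) := by
      field_simp
    rw [h1]
    have hT' : ((2 ^ P : ℕ) : ℝ) * (((rn : ℝ) / rd) ^ N / N !) ≤ s.1 := hT
    push_cast at hT'
    exact mul_le_mul_of_nonneg_right hT' (by positivity)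
  have hA' : ((2 ^ P : ℕ) : ℝ) * expPartial ((rn : ℝ) / rd) N ≤ s.2.2 := hA
  push_cast at hA'
  calc (2 : ℝ) ^ P * Real.exp ((rn : ℝ) / rd)
        ≤ (2 : ℝ) ^ P * (expPartial ((rn : ℝ) / rd) N +
            ((rn : ℝ) / rd) ^ N * (N + 1) / (N ! * N)) := by
          refine mul_le_mul_of_nonneg_left ?_ (by positivity)
          unfold expPartial
          exact hexp
    _ = (2 : ℝ) ^ P * expPartial ((rn : ℝ) / rd) N +
          (2 : ℝ) ^ P * (((rn : ℝ) / rd) ^ N * (N + 1) / (N ! * N)) := by ring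
    _ ≤ (s.2.2 : ℝ) + ((cdiv (s.1 * (N + 1)) N : ℕ) : ℝ) := add_le_add hA' hrem
    _ = (expHiSmall P N rn rd : ℝ) := by rw [expHiSmall, ← hs]; push_cast; ring

/-! ## Repeated squaring -/

/-- One directed squaring at scale `C`: `v ↦ v²/C` rounded down or up. [folklore] -/
def sqStep (up : Bool) (C v : ℕ) : ℕ := bif up then cdiv (v * v) C else v * v / C

/-- `s` directed squarings. [folklore] -/
def sqIter (up : Bool) (C v : ℕ) : ℕ → ℕ
  | 0 => v
  | s + 1 => sqStep up C (sqIter up C v s)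

/-- Unfolding. [folklore] -/
theorem sqIter_succ (up : Bool) (C v s : ℕ) : sqIter up C v (s + 1) = sqStep up C (sqIter up C v s) := rfl

/-- **Downward squarings track `C y^{2^s}` from below**: `v ≤ C y` (`C > 0`, `y ≥ 0`) gives
`sqIter false C v s ≤ C y^{2^s}`. [folklore] -/
theorem sqIter_false_sound {C v : ℕ} (hC : 0 < C) {y : ℝ} (hy : 0 ≤ y) (hv : (v : ℝ) ≤ C * y) (s : ℕ) :
    (sqIter false C v s : ℝ) ≤ C * y ^ (2 ^ s) := by
  induction s with
  | zero => simpa [sqIter] using hv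
  | succ s ih =>
    rw [sqIter_succ]
    set w := sqIter false C v s with hw
    have hCR : (0 : ℝ) < C := by exact_mod_cast hC
    have hw0 : (0 : ℝ) ≤ w := Nat.cast_nonneg _
    show ((w * w / C : ℕ) : ℝ) ≤ C * y ^ (2 ^ (s + 1))
    calc ((w * w / C : ℕ) : ℝ) ≤ ((w * w : ℕ) : ℝ) / C := natDiv_le_div _ _
      _ ≤ (C * y ^ (2 ^ s)) * (C * y ^ (2 ^ s)) / C := by
          push_cast
          exact div_le_div_of_nonneg_right (mul_le_mul ih ih hw0 (by positivity)) hCR.le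
      _ = C * y ^ (2 ^ (s + 1)) := by
          field_simp
          ring

/-- **Upward squarings track `C y^{2^s}` from above**: `C y ≤ v` (`C > 0`, `y ≥ 0`) gives
`C y^{2^s} ≤ sqIter true C v s`. [folklore] -/
theorem sqIter_true_sound {C v : ℕ} (hC : 0 < C) {y : ℝ} (hy : 0 ≤ y) (hv : C * y ≤ (v : ℝ)) (s : ℕ) :
    C * y ^ (2 ^ s) ≤ (sqIter true C v s : ℝ) := by
  induction s with
  | zero => simpa [sqIter] using hv
  | succ s ih =>
    rw [sqIter_succ]
    set w := sqIter true C v s with hw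
    have hCR : (0 : ℝ) < C := by exact_mod_cast hC
    show (C : ℝ) * y ^ (2 ^ (s + 1)) ≤ ((cdiv (w * w) C : ℕ) : ℝ)
    calc (C : ℝ) * y ^ (2 ^ (s + 1)) = (C * y ^ (2 ^ s)) * (C * y ^ (2 ^ s)) / C := by
          field_simp
          ring
      _ ≤ ((w * w : ℕ) : ℝ) / C := by
          push_cast
          exact div_le_div_of_nonneg_right (mul_le_mul ih ih (by positivity) (Nat.cast_nonneg _)) hCR.le
      _ ≤ ((cdiv (w * w) C : ℕ) : ℝ) := div_le_cdiv hC

/-- The downward squarings stay `≥ C` when started `≥ C` (so they are safe denominators). [folklore] -/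
theorem le_sqIter_false {C v : ℕ} (hC : 0 < C) (hv : C ≤ v) (s : ℕ) : C ≤ sqIter false C v s := by
  induction s with
  | zero => simpa [sqIter] using hv
  | succ s ih =>
    rw [sqIter_succ]
    show C ≤ sqIter false C v s * sqIter false C v s / C
    rw [Nat.le_div_iff_mul_le hC]
    exact Nat.mul_le_mul ih ih

/-! ## `exp` of a signed rational with a squaring hint -/

/-- The hint check `|xnum| ≤ xden · 2^s` together with `0 < xden`, `0 < N`. [folklore] -/
def expHintOk (N s : ℕ) (xnum : ℤ) (xden : ℕ) : Bool :=
  decide (0 < N) && decide (0 < xden) && decide (xnum.natAbs ≤ xden * 2 ^ s)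

/-- Reading the hint check. [folklore] -/
theorem expHintOk_iff {N s : ℕ} {xnum : ℤ} {xden : ℕ} :
    expHintOk N s xnum xden = true ↔ 0 < N ∧ 0 < xden ∧ xnum.natAbs ≤ xden * 2 ^ s := by
  simp [expHintOk, and_assoc]

/-- **`2^P exp(xnum/xden)` from below**: for `xnum ≥ 0` the `s`-fold downward squaring of
`expLoSmall` at `r = xnum/(xden 2^s)`; for `xnum < 0`, `⌊2^{2P} / (upper value at |xnum|)⌋`. [folklore] -/
def expLo (P N s : ℕ) (xnum : ℤ) (xden : ℕ) : ℕ :=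
  if 0 ≤ xnum then sqIter false (2 ^ P) (expLoSmall P N xnum.natAbs (xden * 2 ^ s)) s
  else 2 ^ P * 2 ^ P / sqIter true (2 ^ P) (expHiSmall P N xnum.natAbs (xden * 2 ^ s)) s

/-- **`2^P exp(xnum/xden)` from above**: for `xnum ≥ 0` the `s`-fold upward squaring of `expHiSmall`;
for `xnum < 0`, `⌈2^{2P} / (lower value at |xnum|)⌉`. [folklore] -/
def expHi (P N s : ℕ) (xnum : ℤ) (xden : ℕ) : ℕ :=
  if 0 ≤ xnum then sqIter true (2 ^ P) (expHiSmall P N xnum.natAbs (xden * 2 ^ s)) s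
  else cdiv (2 ^ P * 2 ^ P) (sqIter false (2 ^ P) (expLoSmall P N xnum.natAbs (xden * 2 ^ s)) s)

/-- `exp(|xnum|/xden) = exp(r)^{2^s}` with `r = |xnum|/(xden 2^s)`. [folklore] -/
theorem exp_natAbs_eq_pow {xnum : ℤ} {xden : ℕ} (s : ℕ) :
    Real.exp ((xnum.natAbs : ℝ) / xden) =
      Real.exp ((xnum.natAbs : ℝ) / ((xden * 2 ^ s : ℕ) : ℝ)) ^ (2 ^ s) := by
  rw [← Real.exp_nat_mul]
  congr 1
  push_cast
  rw [div_mul_eq_div_div, mul_div_assoc', mul_comm ((2 : ℝ) ^ s), mul_div_assoc,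
    div_self (pow_ne_zero _ two_ne_zero), mul_one]

/-- The lower squared value at `|x|` is `≥ 2^P` (hence positive). [folklore] -/
theorem two_pow_le_sqIter_expLoSmall (P : ℕ) {N : ℕ} (hN : 0 < N) (rn rd s : ℕ) :
    2 ^ P ≤ sqIter false (2 ^ P) (expLoSmall P N rn rd) s := by
  refine le_sqIter_false (Nat.two_pow_pos P) ?_ s
  -- after the first step the accumulator already contains `T₀ = 2^P`
  obtain ⟨N, rfl⟩ : ∃ M, N = M + 1 := ⟨N - 1, by omega⟩
  unfold expLoSmall
  induction N with
  | zero => simp [expIter, expStep]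
  | succ M ih =>
    rw [expIter_succ, expStep_false]
    dsimp only
    exact le_trans (ih (Nat.succ_pos M)) (Nat.le_add_right _ _)

/-- **Soundness of `expLo` and `expHi`**: with `0 < N`, `0 < xden` and the squaring hint
`|xnum| ≤ xden · 2^s`, `expLo ≤ 2^P · exp(xnum/xden) ≤ expHi`. [folklore] -/
theorem exp_sound (P : ℕ) {N s : ℕ} {xnum : ℤ} {xden : ℕ} (hN : 0 < N) (hden : 0 < xden)
    (hs : xnum.natAbs ≤ xden * 2 ^ s) :
    (expLo P N s xnum xden : ℝ) ≤ (2 : ℝ) ^ P * Real.exp ((xnum : ℝ) / xden) ∧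
      (2 : ℝ) ^ P * Real.exp ((xnum : ℝ) / xden) ≤ (expHi P N s xnum xden : ℝ) := by
  have hrd : 0 < xden * 2 ^ s := Nat.mul_pos hden (Nat.two_pow_pos s)
  have hCpos : 0 < 2 ^ P := Nat.two_pow_pos P
  have hC : ((2 ^ P : ℕ) : ℝ) = (2 : ℝ) ^ P := by push_cast; ring
  set r : ℝ := (xnum.natAbs : ℝ) / ((xden * 2 ^ s : ℕ) : ℝ) with hr
  have hr0 : 0 ≤ r := by positivity
  have hlo_small : (expLoSmall P N xnum.natAbs (xden * 2 ^ s) : ℝ) ≤ ((2 ^ P : ℕ) : ℝ) * Real.exp r := by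
    rw [hC]; exact expLoSmall_sound P N hrd
  have hhi_small : ((2 ^ P : ℕ) : ℝ) * Real.exp r ≤ (expHiSmall P N xnum.natAbs (xden * 2 ^ s) : ℝ) := by
    rw [hC]; exact expHiSmall_sound P hN hrd hs
  have hexp0 : 0 ≤ Real.exp r := (Real.exp_pos r).le
  -- the absolute value: `2^P exp(|x|) ∈ [L, U]`
  have hL := sqIter_false_sound hCpos hexp0 hlo_small s
  have hU := sqIter_true_sound hCpos hexp0 hhi_small s
  rw [← exp_natAbs_eq_pow s, hC] at hL hU
  set L := sqIter false (2 ^ P) (expLoSmall P N xnum.natAbs (xden * 2 ^ s)) s with hLdef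
  set U := sqIter true (2 ^ P) (expHiSmall P N xnum.natAbs (xden * 2 ^ s)) s with hUdef
  have hLpos : (0 : ℝ) < L := by
    have : 2 ^ P ≤ L := two_pow_le_sqIter_expLoSmall P hN _ _ s
    have : 0 < L := lt_of_lt_of_le hCpos this
    exact_mod_cast this
  have habs : ((xnum.natAbs : ℕ) : ℝ) = |(xnum : ℝ)| := by
    rw [Nat.cast_natAbs, Int.cast_abs]
  by_cases hx : 0 ≤ xnum
  · -- non-negative argument
    have hxabs : ((xnum.natAbs : ℕ) : ℝ) = (xnum : ℝ) := by
      rw [habs, abs_of_nonneg (by exact_mod_cast hx)]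
    rw [hxabs] at hL hU
    refine ⟨?_, ?_⟩
    · unfold expLo; rw [if_pos hx]; exact hL
    · unfold expHi; rw [if_pos hx]; exact hU
  · -- negative argument: `exp x = 1 / exp |x|`
    push Not at hx
    have hxabs : ((xnum.natAbs : ℕ) : ℝ) = -(xnum : ℝ) := by
      rw [habs, abs_of_neg (by exact_mod_cast hx)]
    rw [hxabs, neg_div, Real.exp_neg] at hL hU
    have hE : 0 < Real.exp ((xnum : ℝ) / xden) := Real.exp_pos _
    have hUpos : (0 : ℝ) < U := lt_of_lt_of_le (by positivity) hU
    -- `2^P exp x = 2^{2P} / (2^P (exp x)⁻¹)`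
    have hkey : (2 : ℝ) ^ P * Real.exp ((xnum : ℝ) / xden) =
        (2 : ℝ) ^ P * (2 : ℝ) ^ P / ((2 : ℝ) ^ P * (Real.exp ((xnum : ℝ) / xden))⁻¹) := by
      field_simp
    refine ⟨?_, ?_⟩
    · unfold expLo
      rw [if_neg (not_le.2 hx), ← hUdef]
      calc ((2 ^ P * 2 ^ P / U : ℕ) : ℝ) ≤ ((2 ^ P * 2 ^ P : ℕ) : ℝ) / U := natDiv_le_div _ _
        _ ≤ (2 : ℝ) ^ P * (2 : ℝ) ^ P / ((2 : ℝ) ^ P * (Real.exp ((xnum : ℝ) / xden))⁻¹) := by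
            push_cast
            exact div_le_div_of_nonneg_left (by positivity) (by positivity) hU
        _ = (2 : ℝ) ^ P * Real.exp ((xnum : ℝ) / xden) := hkey.symm
    · unfold expHi
      rw [if_neg (not_le.2 hx), ← hLdef]
      calc (2 : ℝ) ^ P * Real.exp ((xnum : ℝ) / xden)
            = (2 : ℝ) ^ P * (2 : ℝ) ^ P / ((2 : ℝ) ^ P * (Real.exp ((xnum : ℝ) / xden))⁻¹) := hkey
        _ ≤ ((2 ^ P * 2 ^ P : ℕ) : ℝ) / L := by
            push_cast
            exact div_le_div_of_nonneg_left (by positivity) hLpos hL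
        _ ≤ ((cdiv (2 ^ P * 2 ^ P) L : ℕ) : ℝ) := div_le_cdiv (by exact_mod_cast hLpos)

/-- **The hint-checked form** (what a kernel checker uses). [folklore] -/
theorem exp_sound_of_hintOk (P : ℕ) {N s : ℕ} {xnum : ℤ} {xden : ℕ}
    (h : expHintOk N s xnum xden = true) :
    (expLo P N s xnum xden : ℝ) ≤ (2 : ℝ) ^ P * Real.exp ((xnum : ℝ) / xden) ∧
      (2 : ℝ) ^ P * Real.exp ((xnum : ℝ) / xden) ≤ (expHi P N s xnum xden : ℝ) :=
  exp_sound P (expHintOk_iff.1 h).1 (expHintOk_iff.1 h).2.1 (expHintOk_iff.1 h).2.2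

/-! ## Kernel smoke tests

`P = 30`, `N = 12`, `s = 3`: the kernel's enclosure of `2^30 · e` is `[2918732844, 2918733069]`
(true value `2918732888.6…`), and of `2^30 · e^{−5/2}` is `[88138092, 88138099]` (`88138096.1…`);
the certificates use `P = 80`, `N = 30`, for which the relative width at `x = 37` is `< 10^{−21}`. -/

example : expLo 30 12 3 1 1 = 2918732844 ∧ expHi 30 12 3 1 1 = 2918733069 := by decide +kernel

example : expHintOk 12 3 (-5) 2 = true ∧ expLo 30 12 3 (-5) 2 = 88138092 ∧
    expHi 30 12 3 (-5) 2 = 88138099 := by decide +kernel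

end FixedPoint

end Literature.Computability.AlgebraicComplexity

end
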